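import Summits.RiemannHypothesis.RiemannHypothesis.Theorems.HandoffSemilocalOddBump
import Summits.RiemannHypothesis.RiemannHypothesis.Theorems.HandoffWallSequence
import Summits.RiemannHypothesis.RiemannHypothesis.Theorems.SemilocalDeletionCliffMulti
import HarnessLib

/-!
# HANDOFF — the DEFICIT SLOPE: past `(log N)/2` the truncated form's bottom drops at least linearly, with slope `≍ √N` (rh-explicit, track «HANDOFF», seat prove-2 gen5, ATTEMPT-12 part 3)

HONEST FRAMING. Nothing here bears on the truth of RH. Quantitative form of the wall ceiling (`HandoffWallCeiling.lean`): for every finite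
`S ⊆ [0, N)` (`N ≥ 10⁷`) and every `0 < δ ≤ 1/4`, the semi-local ground energy of `S` on the window `(log N)/2 + δ` satisfies, RH-free,

  `λ_min(S; (log N)/2 + δ) ≤ log(2/δ) + cramerEnergyConst + 6.1 − √N·δ/(2e‖φ₀‖₂²)`   (`semilocalGroundEnergy_le_slope`),

equivalently for the wall sequence's aggregate deficit `D_N(b) = −λ_min({p < N}; b)` (theory-2's `aggregateDeficit`):

  `D_N((log N)/2 + δ) ≥ √N·δ/(2e‖φ₀‖₂²) − log(2/δ) − cramerEnergyConst − 6.1`   (`aggregateDeficit_ge_slope`).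

READING. The primes missing from `S` on that window, `N ≤ p ≤ N e^{2δ}`, carry total explicit-formula weight `Σ log p/√p ≈ 2√N·δ`; the theorem says the
truncated form's deficit is at least a FIXED FRACTION `1/(4e‖φ₀‖₂²)` of that weight, up to `O(log(1/δ))` — the aggregate, RH-free LOWER companion of the
handoff inequality `deficit ≤ contribution` (which, per test function and per window, is RH). The wall ceiling is the sign consequence (the right side is
positive once `δ ≳ (log N)/√N`). Under RH the slope is TWO-SIDED: `D_N((log N)/2 + δ) ≤ Σ_{N ≤ p ≤ N e^{2δ}} log p/√p`, the full missing
weight (`aggregateDeficit_le_missingWeight_of_riemannHypothesis`, from cc-s2-1's multi-prime deletion floor + Weil positivity on the window) — so under RH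
the deficit of the truncated form past the coincidence point is pinned between a fixed fraction of, and all of, the weight of the absent primes. Witness and constants: gen2's Cramér bump (`HandoffCramerBump.lean`) antisymmetrised, radius `r = δ/2`, through the
semi-local odd two-bump bound of part 1 (`re_weilSemilocalQuadratic_sub_comp_neg_le`); `‖φ₀‖₂² = weilNorm2Sq (moll 0) ≥ 1/2` and `cramerEnergyConst` are
symbolic (Mathlib's unspecified bump). No prime gap, zero of `ζ` or certificate is used.

References: E. Bombieri, Rend. Mat. Acc. Lincei (9) 11 (2000), Thm 2 / §4 Problem 2 (`Bombieri2000Weil`); A. Connes, C. Consani, Enseign. Math. 69 (2023) 93–148 = arXiv:2106.01715,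
§2.2–2.4 (`ConnesConsani2023`, smallest eigenvalue of the semi-local form with and without a prime).
-/

set_option linter.dupNamespace false

noncomputable section

open Complex Filter Set MeasureTheory Literature.NumberTheory.LFunctions
  Literature.NumberTheory.LFunctions.WeilContinuous
open Summit.RiemannHypothesis.RiemannHypothesis.Theorems.HandoffSemilocalEnergy (semilocalGroundEnergy aggregateDeficit
  semilocalGroundEnergy_mul_le_re le_semilocalGroundEnergy semilocalSphereValues_top_nonempty)
open Summit.RiemannHypothesis.RiemannHypothesis.Theorems.HandoffDecomposition (primeFactors_subset_primesBelow_of_lt)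
open Summit.RiemannHypothesis.RiemannHypothesis.Theorems.SemilocalDeletionCliff
  (re_weilSemilocalQuadratic_sdiff_ge_of_weilPositivityOn)
open scoped Real Topology ComplexConjugate ContDiff ArithmeticFunction.vonMangoldt

namespace Summit.RiemannHypothesis.RiemannHypothesis.Theorems.Handoff

variable {f : ℝ → ℂ} {S : Finset ℕ} {N : ℕ}

/-! ## §1 The `L²` mass of an antisymmetrised lobe -/

/-- For a lobe `f ⊆ [c′, b]` with `c′ > 0` the two halves of `f − f(−·)` have disjoint supports, so pointwise
`‖f(x) − f(−x)‖² = ‖f(x)‖² + ‖f(−x)‖²`. [folklore] -/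
theorem norm_sq_sub_comp_neg_eq {c' b : ℝ} (hc' : 0 < c') (hfs : tsupport f ⊆ Icc c' b) (x : ℝ) :
    ‖f x - f (-x)‖ ^ 2 = ‖f x‖ ^ 2 + ‖f (-x)‖ ^ 2 := by
  have hzero : ∀ y : ℝ, y ∉ Icc c' b → f y = 0 := fun y hy ↦ image_eq_zero_of_notMem_tsupport fun h ↦ hy (hfs h)
  rcases le_or_gt 0 x with hx | hx
  · rw [hzero (-x) (fun hm ↦ by linarith [hm.1])]; simp
  · rw [hzero x (fun hm ↦ by linarith [hm.1])]; simp

/-- Hence `∫‖f − f(−·)‖² = 2·∫‖f‖²` for a Weil test lobe `f ⊆ [c′, b]`, `c′ > 0`. [folklore] -/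
theorem integral_norm_sq_sub_comp_neg (hf : IsWeilTest f) {c' b : ℝ} (hc' : 0 < c') (hfs : tsupport f ⊆ Icc c' b) :
    ∫ x : ℝ, ‖f x - f (-x)‖ ^ 2 = 2 * ∫ x : ℝ, ‖f x‖ ^ 2 := by
  simp_rw [norm_sq_sub_comp_neg_eq hc' hfs]
  rw [integral_add hf.integrable_norm_sq (hf.integrable_norm_sq.comp_neg),
    integral_neg_eq_self (fun u : ℝ ↦ ‖f u‖ ^ 2) volume]
  ring

/-! ## §2 The odd two-bump in `Q_S`, `S ⊆ [0, N)`: the explicit energy bound for every radius `r ≤ 1/8` -/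

/-- **The odd Cramér two-bump in every truncated form.** For `S ⊆ [0, N)`, `N ≥ 10⁷`, `0 < r ≤ 1/8`, with `x₀ = (log N)/2 + r`,
`f = cramerBump r x₀` and `Φ = ‖φ₀‖₂²`:
`Re Q_S(f − f(−·)) ≤ 2rΦ·(log(1/r) + cramerEnergyConst + 6.1) − 2e^{x₀−1}r²`
(part 1's witness-side bound; the lag range `(log N, log N + 4r)` carries only higher powers of members of `S`, `≤ 3` in `Λ/√n`-mass, and an
archimedean tail `≤ 0.002`). [this track, ATTEMPT-12 §2] -/
theorem re_weilSemilocalQuadratic_oddBump_le (hS : ∀ p ∈ S, p < N) (hN7 : (10 : ℝ) ^ 7 ≤ N) {r : ℝ} (hr : 0 < r)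
    (hr8 : r ≤ 1 / 8) :
    (weilSemilocalQuadratic S (fun x ↦ cramerBump r (Real.log N / 2 + r) x - cramerBump r (Real.log N / 2 + r) (-x))).re ≤
      2 * (r * weilNorm2Sq (moll 0)) * (Real.log (1 / r) + cramerEnergyConst + 6.1) -
        2 * (Real.exp (Real.log N / 2 + r - 1) * r ^ 2) := by
  have hN0 : (0 : ℝ) < N := lt_of_lt_of_le (by norm_num) hN7
  have h16 : Real.exp 16 ≤ N := exp_sixteen_le.trans hN7
  have hlog16 : (16 : ℝ) ≤ Real.log N := by
    rw [Real.le_log_iff_exp_le hN0]; exact h16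
  have hr4 : r ≤ 1 / 4 := by linarith only [hr8]
  have hr1 : r ≤ 1 := by linarith only [hr8]
  set c' : ℝ := Real.log N / 2 with hc'_def
  have hc'8 : 8 ≤ c' := by rw [hc'_def]; linarith only [hlog16]
  have hc'pos : 0 < c' := by linarith only [hc'8]
  set x₀ : ℝ := c' + r with hx₀_def
  set b : ℝ := c' + 2 * r with hb_def
  have hcb : c' ≤ b := by rw [hb_def]; linarith only [hr]
  have hexp2b : Real.exp (2 * b) = N * Real.exp (4 * r) := by
    rw [hb_def, show 2 * (c' + 2 * r) = Real.log N + 4 * r by rw [hc'_def]; ring, Real.exp_add, Real.exp_log hN0]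
  have hNb : (N : ℝ) ≤ Real.exp (2 * b) := by
    rw [hexp2b]
    have h1 : 1 ≤ Real.exp (4 * r) := Real.one_le_exp (by positivity)
    nlinarith only [h1, hN0]
  have h2N : Real.exp (2 * b) ≤ 2 * N := by
    rw [hexp2b]
    have he : Real.exp (4 * r) ≤ Real.exp (1 / 2) := Real.exp_le_exp.2 (by linarith only [hr8])
    have hsq : Real.exp (1 / 2) * Real.exp (1 / 2) = Real.exp 1 := by rw [← Real.exp_add]; norm_num
    have he2 : Real.exp (1 / 2) ≤ 2 := by nlinarith [Real.exp_pos (1 / 2), Real.exp_one_lt_d9]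
    nlinarith only [he.trans he2, hN0]
  set f := cramerBump r x₀ with hf_def
  have hf : IsWeilTest f := isWeilTest_cramerBump hr x₀
  have hfs : tsupport f ⊆ Icc c' b := by
    refine (tsupport_cramerBump_subset hr x₀).trans (Icc_subset_Icc ?_ ?_)
    · rw [hx₀_def]; linarith only
    · rw [hx₀_def, hb_def]; linarith only
  have hE := re_weilSemilocalQuadratic_cramerBump_le S hr hr4 x₀
  have hP := normSq_weilMellin_cramerBump_one_ge hr hr1 x₀
  have hNf : ∫ x : ℝ, ‖f x‖ ^ 2 = r * weilNorm2Sq (moll 0) := integral_norm_sq_cramerBump hr x₀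
  set Φ := weilNorm2Sq (moll 0) with hΦ
  have hΦ0 : 1 / 2 ≤ Φ := half_le_weilNorm2Sq_moll_zero
  have hrΦ : 0 ≤ r * Φ := by
    have : 0 < Φ := by linarith only [hΦ0]
    positivity
  set G := ∑ n ∈ Finset.Icc ⌈Real.exp (2 * c')⌉₊ ⌊Real.exp (2 * b)⌋₊, weilSemilocalCoeff S n with hG_def
  have hB : G ≤ 3 := sum_weilSemilocalCoeff_le_three hS hN7 hNb h2N
  have hM : archGapBound c' ≤ 0.002 := by
    unfold archGapBound
    have he : (1000 : ℝ) ≤ Real.exp c' := exp_seven_ge.trans (Real.exp_le_exp.2 (by linarith only [hc'8]))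
    have hx : Real.exp (-(4 * c')) ≤ 1 / 2 := by
      have h1 : Real.exp (-(4 * c')) ≤ Real.exp (-1) := Real.exp_le_exp.2 (by linarith only [hc'8])
      have h2 := Real.exp_neg_one_lt_d9
      linarith only [h1, h2]
    have hden : (500 : ℝ) ≤ Real.exp c' * (1 - Real.exp (-(4 * c'))) := by
      nlinarith only [he, hx, Real.exp_pos c']
    rw [div_le_iff₀ (by linarith only [hden])]
    linarith only [hden]
  have hX : 4 * archGapBound c' * (b - c') + 2 * G ≤ 6.1 := by
    have hM0 : 0 ≤ archGapBound c' := (archGapBound_pos hc'pos).le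
    have hbc : b - c' ≤ 1 := by rw [hb_def]; linarith only [hr8]
    have hbc0 : 0 ≤ b - c' := by linarith only [hcb]
    have hprod : archGapBound c' * (b - c') ≤ 0.002 * 1 := mul_le_mul hM hbc hbc0 (by norm_num)
    linarith only [hprod, hB]
  have hU := re_weilSemilocalQuadratic_sub_comp_neg_le S hf hc'pos hcb hfs
  have h0 : 0 ≤ Complex.normSq (weilMellin f 0) := Complex.normSq_nonneg _
  rw [hNf] at hE hU
  have hX' : 2 * (4 * archGapBound c' * (b - c') + 2 * G) * (r * Φ) ≤ 2 * 6.1 * (r * Φ) := by nlinarith only [hX, hrΦ]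
  have hx1 : Real.exp (Real.log N / 2 + r - 1) * r ^ 2 = Real.exp (x₀ - 1) * r ^ 2 := by rw [hx₀_def, hc'_def]
  rw [hx1]
  nlinarith only [hU, hE, hX', hP, h0, hrΦ]

/-! ## §3 The deficit slope -/

/-- **DEFICIT SLOPE, energy form (RH-free).** For every finite `S ⊆ [0, N)`, `N ≥ 10⁷`, and `0 < δ ≤ 1/4`:
`λ_min(S; (log N)/2 + δ) ≤ log(2/δ) + cramerEnergyConst + 6.1 − √N·δ/(2e‖φ₀‖₂²)` — past the coincidence window the bottom of the truncated form
drops at least linearly in the excess `δ`, with slope `√N/(2e‖φ₀‖₂²)`. [this track, ATTEMPT-12 part 3; cite: Bombieri2000Weil, §4 Problem 2 (the window infimum)] -/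
theorem semilocalGroundEnergy_le_slope (hS : ∀ p ∈ S, p < N) (hN7 : (10 : ℝ) ^ 7 ≤ N) {δ : ℝ} (hδ : 0 < δ) (hδ4 : δ ≤ 1 / 4) :
    semilocalGroundEnergy S (fun _ ↦ True) (Real.log N / 2 + δ) ≤
      Real.log (2 / δ) + cramerEnergyConst + 6.1 - Real.sqrt N * δ / (2 * Real.exp 1 * weilNorm2Sq (moll 0)) := by
  have hN0 : (0 : ℝ) < N := lt_of_lt_of_le (by norm_num) hN7
  have hlog16 : (16 : ℝ) ≤ Real.log N := by
    rw [Real.le_log_iff_exp_le hN0]; exact exp_sixteen_le.trans hN7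
  set r : ℝ := δ / 2 with hr_def
  have hr : 0 < r := by positivity
  have hr8 : r ≤ 1 / 8 := by rw [hr_def]; linarith only [hδ4]
  set c' : ℝ := Real.log N / 2 with hc'_def
  have hc'pos : 0 < c' := by rw [hc'_def]; linarith only [hlog16]
  set x₀ : ℝ := c' + r with hx₀_def
  have hwin : Real.log N / 2 + δ = c' + 2 * r := by rw [hc'_def, hr_def]; ring
  -- the witness bound of §2 (obtained before the abbreviations below, so that they rewrite it)
  have hW := re_weilSemilocalQuadratic_oddBump_le hS hN7 hr hr8
  have hx₀eq : Real.log N / 2 + r = x₀ := by rw [hx₀_def, hc'_def]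
  rw [hx₀eq] at hW
  set f := cramerBump r x₀ with hf_def
  have hf : IsWeilTest f := isWeilTest_cramerBump hr x₀
  have hfs : tsupport f ⊆ Icc c' (c' + 2 * r) := by
    refine (tsupport_cramerBump_subset hr x₀).trans (Icc_subset_Icc ?_ ?_)
    · rw [hx₀_def]; linarith only
    · rw [hx₀_def]; linarith only
  set F : ℝ → ℂ := fun x ↦ f x - f (-x) with hF_def
  have hF : IsWeilTest F := isWeilTest_sub_comp_neg hf
  have hFs : tsupport F ⊆ Icc (-(c' + 2 * r)) (c' + 2 * r) :=
    tsupport_sub_comp_neg_subset hc'pos.le (by linarith only [hr]) hfs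
  set Φ := weilNorm2Sq (moll 0) with hΦ
  have hΦ0 : 1 / 2 ≤ Φ := half_le_weilNorm2Sq_moll_zero
  have hΦpos : 0 < Φ := by linarith only [hΦ0]
  -- Rayleigh: `λ · ∫‖F‖² ≤ Re Q_S(F)`, with `∫‖F‖² = 2rΦ`
  have hRay := semilocalGroundEnergy_mul_le_re (S := S) (P := fun _ ↦ True) hF hFs (fun _ _ ↦ trivial)
  have hI : ∫ x : ℝ, ‖F x‖ ^ 2 = 2 * (r * Φ) := by
    rw [hF_def, integral_norm_sq_sub_comp_neg hf hc'pos hfs, integral_norm_sq_cramerBump hr x₀]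
  rw [hI] at hRay
  -- `e^{x₀ − 1} ≥ √N / e`
  have hexp : Real.sqrt N * Real.exp (-1) ≤ Real.exp (x₀ - 1) := by
    have e1 : Real.exp (x₀ - 1) = Real.exp c' * Real.exp r * Real.exp (-1) := by
      rw [hx₀_def, ← Real.exp_add, ← Real.exp_add]; exact congrArg Real.exp (by ring)
    have hexpc' : Real.exp c' = Real.sqrt N := by
      rw [hc'_def, show Real.log N / 2 = Real.log N * (1 / 2) by ring, Real.exp_mul, Real.exp_log hN0, Real.sqrt_eq_rpow]
    rw [e1, hexpc']
    have h1 : 1 ≤ Real.exp r := Real.one_le_exp hr.le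
    have h0 : 0 ≤ Real.sqrt N * Real.exp (-1) := by positivity
    nlinarith only [h1, h0]
  set L := semilocalGroundEnergy S (fun _ ↦ True) (c' + 2 * r) with hL_def
  set A := Real.log (1 / r) + cramerEnergyConst + 6.1 with hA_def
  have h2 := mul_le_mul_of_nonneg_right hexp (sq_nonneg r)
  have hmain : L * (2 * (r * Φ)) ≤ 2 * (r * Φ) * A - 2 * (Real.sqrt N * Real.exp (-1) * r ^ 2) := by
    have h3 := hRay.trans hW
    linarith only [h3, h2]
  have hrΦ : 0 < 2 * (r * Φ) := by positivity
  have hdiv : L ≤ A - Real.sqrt N * Real.exp (-1) * r / Φ := by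
    by_contra hcon
    rw [not_le] at hcon
    have hm := mul_lt_mul_of_pos_right hcon hrΦ
    have e : (A - Real.sqrt N * Real.exp (-1) * r / Φ) * (2 * (r * Φ)) =
        2 * (r * Φ) * A - 2 * (Real.sqrt N * Real.exp (-1) * r ^ 2) := by
      field_simp
    linarith only [hm, hmain, e]
  have hlr : Real.log (1 / r) = Real.log (2 / δ) := by rw [hr_def, one_div_div]
  have hlast : Real.sqrt N * Real.exp (-1) * r / Φ = Real.sqrt N * δ / (2 * Real.exp 1 * Φ) := by
    rw [div_eq_div_iff hΦpos.ne' (by positivity), hr_def]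
    have hee : Real.exp (-1) * Real.exp 1 = 1 := by rw [← Real.exp_add]; norm_num
    linear_combination (Real.sqrt N * δ * Φ) * hee
  rw [hwin, ← hlr, ← hlast]
  rw [hA_def] at hdiv
  exact hdiv

/-- **DEFICIT SLOPE, handoff form (RH-free).** For the wall sequence's aggregate deficit `D_N(b) = −λ_min({p < N}; b)`:
`D_N((log N)/2 + δ) ≥ √N·δ/(2e‖φ₀‖₂²) − log(2/δ) − cramerEnergyConst − 6.1` for `N ≥ 10⁷`, `0 < δ ≤ 1/4` — the `{p < N}`-form misses at least a
fixed fraction of the weight `Σ_{N ≤ p ≤ N e^{2δ}} log p/√p ≈ 2√N·δ` of the primes absent from it. [this track, ATTEMPT-12 part 3] -/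
theorem aggregateDeficit_ge_slope (hN7 : (10 : ℝ) ^ 7 ≤ N) {δ : ℝ} (hδ : 0 < δ) (hδ4 : δ ≤ 1 / 4) :
    Real.sqrt N * δ / (2 * Real.exp 1 * weilNorm2Sq (moll 0)) - Real.log (2 / δ) - cramerEnergyConst - 6.1 ≤
      aggregateDeficit N (Real.log N / 2 + δ) := by
  have h := semilocalGroundEnergy_le_slope (fun _ hp ↦ Nat.lt_of_mem_primesBelow hp) hN7 hδ hδ4
  unfold aggregateDeficit
  linarith only [h]

/-- The slope is at least `√N/(2e‖φ₀‖₂²) > 0` and the intercept is `O(log(1/δ))`: in particular, for `δ = 1/4`,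
`D_N((log N)/2 + 1/4) ≥ √N/(8e‖φ₀‖₂²) − log 8 − cramerEnergyConst − 6.1` — the deficit a quarter past the coincidence point is `≫ √N`. [this track, ATTEMPT-12 part 3] -/
theorem aggregateDeficit_quarter_ge (hN7 : (10 : ℝ) ^ 7 ≤ N) :
    Real.sqrt N / (8 * Real.exp 1 * weilNorm2Sq (moll 0)) - Real.log 8 - cramerEnergyConst - 6.1 ≤
      aggregateDeficit N (Real.log N / 2 + 1 / 4) := by
  have h := aggregateDeficit_ge_slope hN7 (by norm_num : (0 : ℝ) < 1 / 4) le_rfl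
  have e1 : Real.log (2 / (1 / 4 : ℝ)) = Real.log 8 := by norm_num
  have e2 : Real.sqrt N * (1 / 4) / (2 * Real.exp 1 * weilNorm2Sq (moll 0)) =
      Real.sqrt N / (8 * Real.exp 1 * weilNorm2Sq (moll 0)) := by
    field_simp
    ring
  rw [e1, e2] at h
  exact h

/-! ## §4 Under RH the slope is two-sided: the deficit never exceeds the missing weight -/

/-- **Under RH the aggregate deficit is at most the missing weight**: for `N ≥ 2` and `0 < δ < (log N)/2`,
`D_N((log N)/2 + δ) ≤ Σ_{p prime, N ≤ p ≤ ⌊N e^{2δ}⌋} log p/√p` — Weil positivity on the window `b = (log N)/2 + δ` (Yoshida/Bombieri: RH ⇒ positivity)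
and cc-s2-1's multi-prime deletion floor (`re_weilSemilocalQuadratic_sdiff_ge_of_weilPositivityOn`: deleting the primes `N ≤ p ≤ e^{2b}`, each a single
visible atom since `log p > b`, costs at most their total weight). With `aggregateDeficit_ge_slope`: under RH the deficit past the coincidence point lies between
a fixed fraction of `√N·δ` and the full missing weight `≈ 2√N·δ`. [cite: Bombieri2000Weil, Thm 2 (RH ⇒ positivity); this track, ATTEMPT-12 part 3] -/
theorem aggregateDeficit_le_missingWeight_of_riemannHypothesis (hRH : RiemannHypothesis) (hN : 2 ≤ N) {δ : ℝ}
    (hδ : 0 < δ) (hδN : δ < Real.log N / 2) :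
    aggregateDeficit N (Real.log N / 2 + δ) ≤
      ∑ p ∈ (Finset.Icc N ⌊(N : ℝ) * Real.exp (2 * δ)⌋₊).filter Nat.Prime, Real.log p / Real.sqrt p := by
  have hN0 : (0 : ℝ) < N := by exact_mod_cast lt_of_lt_of_le (by norm_num) hN
  have hlogN : 0 < Real.log N := Real.log_pos (by exact_mod_cast lt_of_lt_of_le (by norm_num) hN)
  set b : ℝ := Real.log N / 2 + δ with hb_def
  have hb0 : 0 < b := by rw [hb_def]; positivity
  have hblt : b < Real.log N := by rw [hb_def]; linarith only [hδN]
  set M : ℕ := ⌊(N : ℝ) * Real.exp (2 * δ)⌋₊ with hM_def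
  have hexp2b : Real.exp (2 * b) = N * Real.exp (2 * δ) := by
    rw [hb_def, show 2 * (Real.log N / 2 + δ) = Real.log N + 2 * δ by ring, Real.exp_add, Real.exp_log hN0]
  have hNM : N ≤ M := by
    rw [hM_def]
    refine Nat.le_floor ?_
    have h1 : 1 ≤ Real.exp (2 * δ) := Real.one_le_exp (by positivity)
    nlinarith only [h1, hN0]
  -- the places: `S` = all primes `≤ M`, `D` = the primes in `[N, M]`, `S \ D = {p < N}`
  set S : Finset ℕ := Nat.primesBelow (M + 1) with hS_def
  set D : Finset ℕ := (Finset.Icc N M).filter Nat.Prime with hD_def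
  have hDS : D ⊆ S := by
    intro p hp
    rw [hD_def, Finset.mem_filter, Finset.mem_Icc] at hp
    exact Nat.mem_primesBelow.2 ⟨Nat.lt_succ_of_le hp.1.2, hp.2⟩
  have hSD : S \ D = Nat.primesBelow N := by
    ext p
    rw [Finset.mem_sdiff, hS_def, hD_def, Nat.mem_primesBelow, Nat.mem_primesBelow, Finset.mem_filter, Finset.mem_Icc]
    constructor
    · rintro ⟨⟨hpM, hp⟩, hnot⟩
      refine ⟨?_, hp⟩
      by_contra hge
      exact hnot ⟨⟨not_lt.1 hge, Nat.le_of_lt_succ hpM⟩, hp⟩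
    · rintro ⟨hpN, hp⟩
      exact ⟨⟨lt_of_lt_of_le hpN (hNM.trans (Nat.le_succ M)), hp⟩, fun h ↦ absurd h.1.1 (not_le.2 hpN)⟩
  have hSall : ∀ n ≤ M, IsPrimePow n → n.primeFactors ⊆ S := primeFactors_subset_primesBelow_of_lt (Nat.lt_succ_self M)
  have hcN : b ≤ Real.log ((M : ℝ) + 1) / 2 := by
    have h1 : Real.exp (2 * b) < (M : ℝ) + 1 := by rw [hexp2b, hM_def]; exact Nat.lt_floor_add_one _
    have h2 : 2 * b < Real.log ((M : ℝ) + 1) := by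
      rw [Real.lt_log_iff_exp_lt (by positivity)]; exact h1
    linarith only [h2]
  have hpos : WeilPositivityOn b := (riemannHypothesis_iff_forall_weilPositivityOn.1 hRH) b hb0
  have hprime : ∀ p ∈ D, p.Prime := fun p hp ↦ (Finset.mem_filter.1 hp).2
  have hlog : ∀ p ∈ D, b < Real.log p := by
    intro p hp
    have hpN : N ≤ p := (Finset.mem_Icc.1 (Finset.mem_filter.1 hp).1).1
    have h1 : Real.log N ≤ Real.log p := Real.log_le_log hN0 (by exact_mod_cast hpN)
    exact hblt.trans_le h1
  -- the floor, on the unit sphere of `C(b)`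
  set W : ℝ := ∑ p ∈ D, Real.log p / Real.sqrt p with hW_def
  have hfloor : -W ≤ semilocalGroundEnergy (Nat.primesBelow N) (fun _ ↦ True) b := by
    refine le_semilocalGroundEnergy (semilocalSphereValues_top_nonempty _ hb0) fun g hg hs _ hn ↦ ?_
    have h := re_weilSemilocalQuadratic_sdiff_ge_of_weilPositivityOn hg hSall hcN hpos hs D hDS hprime hlog
    rw [hSD, hn, mul_one] at h
    exact h
  unfold aggregateDeficit
  linarith only [hfloor]

end Summit.RiemannHypothesis.RiemannHypothesis.Theorems.Handoff
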